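import Literature.NumberTheory.EllipticCurves.Rank1Residual.X11aPrintCertificates.ClaimMu
import HarnessLib

/-!
# Class X11a — PRINT-route certificate records: μ SYMBOL TABLES (schema, kernel recheck of the unit Riemann sum, claim)

Cell `bsd-print-x11a` (D-0131 (2) print tier), typer seat ty3; the literature seat's TURNKEY T33
(2026-08-27T17:56:51Z, DOSSIER §33): the dictionary «unit Teichmüller-coset sum at `p ‖ N` ⇒ some
coefficient of `ϖ·L_p` is a `p`-adic unit» — ASSUMED by `ClaimMu.lean` (`Record.MuClaim`) — is a TREE
THEOREM by name for a SYMBOL TABLE: `Summit.….X11b.muAnZeroAt_of_symbolTable_modP` (sister cell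
`b2b-bsdres`, `Summits/…/X11b/ClassClosureSymbolTableModP.lean`) concludes `X11a.MuAnZeroAt W p` from a
multiplicative `p`, ONE newform `f₀` of `W` with period ratio `ϖ₀`, a `p`-unit `u`, the IDENTIFICATION
`x = u·ϖ₀·[·]⁺_{f₀}` of an engine's symbol function, an all-levels bound, an index `k < p^{n₀}` and ONE unit
Riemann sum `‖RS k n₀‖_p = 1`, where (odd `p`, `γ = 1 + p`, `ω` = Teichmüller)
`RS k n₀ = Σ_{ξ ∈ μ_{p−1}} Σ_{s < p^{n₀}} (±1)·x(ω(ξ)·γ^s / p^{n₀+1})·C(s, k)` — a ℤ-linear combination of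
the TEICHMÜLLER-COSET SUMS of the level-`(n₀+1)` table (the `±` is `(−1)^{n₀+1}` at a non-split `p`).

THIS FILE (Literature side = DATA + its decidable recheck + the claim; the composition with the X11b
theorem is Summits-side, ty2's interface): `MuTable` — for one pair, the COMPLETE level-`n` table of plus
modular symbols `x(a/pⁿ)` (`x(0) = L(E,1)/Ω_E` normalisation; every unit `a mod pⁿ`), as produced
IDENTICALLY by the seat's two engines (S = eclib modular symbols, P = PARI twisted `L`-values; kit jobs of
the `RecordsLeafNonSurjMu*` / `RecordsThreeNonSurjMu` display files), and the index `lam`; the kernel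
recheck `MuTable.check` re-verifies the table's shape (all units, denominators prime to `p`, evenness
`x(−a) = x(a)`), recomputes every coset sum `c_s = Σ_{c=1}^{p−1} x(ω(c)·(1+p)^s mod pⁿ)` and every
`RS_k = Σ_s C(s,k)·c_s` MODULO `p` (`powModFast`, `invModFast`), and checks `lam < p^{n−1}`,
`RS_lam ≢ 0 (mod p)` and `RS_k ≡ 0 (mod p)` for all `k < lam` (so `lam` is the λ-invariant of `L_p(E,T)`
by Mazur–Tate–Teitelbaum's compatibility `P_{n} ≡ L_p (mod ω_{n−1})`, given `μ = 0` — display semantics;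
what the Summits door needs is only `RS_lam` a unit). The CLAIM `MuTable.ClaimFor W` is the engines'
statement proper: a newform `f₀` of `W`, its period ratio `ϖ₀`, a `p`-unit `u`, and
`u·ϖ₀·[a/pⁿ]⁺_{f₀} = x(a/pⁿ)` for every displayed entry — SMALLER than `Record.MuClaim` (no dictionary),
and the shape of the `hx`-table hypotheses of `X11b.muAnZeroAt_of_symbolTable_modP`.

Per pair (E1 currency); plain data; no named fact; nothing here is a class theorem; nothing moves a label.

References: B. Mazur, J. Tate, J. Teitelbaum, Invent. Math. 84 (1986) §I.10, §I.12–§I.13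
[MazurTateTeitelbaum1986Invent]; W. Stein, C. Wuthrich, Math. Comp. 82 (2013) §3 (Riemann sums `P_n`,
(3.2)–(3.5)) [SteinWuthrich2013]; R. Greenberg, LNM 1716 (1999) Conj. 1.11, §4 [GreenbergLNM1716]; tree
files `Summits/…/X11b/ClassClosureSymbolTable{Certificate,ModP}.lean`,
`Literature/…/PAdicLFunctionRiemannSumCongruenceCertificateProofs.lean`, `X11aPrintCertificates/{Schema,ClaimMu}.lean`.
-/

set_option autoImplicit false

noncomputable section

open scoped Classical MatrixGroups ModularForm

open CongruenceSubgroup WeierstrassCurve Literature.NumberTheory.EllipticCurves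
  Literature.NumberTheory.EllipticCurves.ModularForms

namespace Literature.NumberTheory.EllipticCurves.Rank1Residual.X11aPrintCertificates

open Literature.NumberTheory.EllipticCurves.Rank1Residual.X11RankOneCertificates (isPrimeBelow504100
  strictlyIncreasing)

/-- A **μ SYMBOL TABLE** for one pair `(E, p)`: the complete level-`n` table `values = [(a, num, den), …]`
of the plus modular symbols `x(a/pⁿ) = num/den` (`x(0) = L(E,1)/Ω_E`; every unit `a mod pⁿ`, increasing),
the split bit (sign `(−1)^n` of the non-split Riemann sums — immaterial modulo `p`), the displayed `x(0)`,
and the index `lam` of the first unit Riemann sum. Keyed to a `Record` by `(label, p, ainvs, conductor)`.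
[cite: SteinWuthrich2013, §3 (3.2)–(3.5) (the Riemann sums P_n of modular symbols)]
[cite: MazurTateTeitelbaum1986Invent, §I.10 and §I.12] -/
structure MuTable where
  /-- Cremona label. -/
  label : String
  /-- a-invariants of the reduced minimal model. -/
  ainvs : List ℤ
  /-- Conductor `N`. -/
  conductor : ℕ
  /-- The prime `p` (odd, `p ‖ N`). -/
  p : ℕ
  /-- Split (`a_p = +1`) or non-split (`a_p = −1`). -/
  split : Bool
  /-- Table level `n ≥ 1` (arguments `a/pⁿ`). -/
  n : ℕ
  /-- The certified index: `RS_lam` is a `p`-unit and `RS_k ≡ 0 (mod p)` for `k < lam` (`= λ(L_p)`). -/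
  lam : ℕ
  /-- `x(0) = L(E,1)/Ω_E` as `(num, den)` (display; the record's `lRatio`). -/
  x0 : ℤ × ℕ
  /-- The table `(a, num, den)`: `x(a/pⁿ) = num/den` for every unit `a mod pⁿ`, increasing in `a`. -/
  values : List (ℕ × ℤ × ℕ)
  /-- Provenance (engines, kit jobs). -/
  engines : List String
  deriving DecidableEq

namespace MuTable

variable (t : MuTable)

/-- `pⁿ`. [folklore] -/
def q : ℕ := t.p ^ t.n

/-- The residue `num·den⁻¹ mod p` of the table entry at `a` (`none` if `a` is absent). [folklore] -/
def resAt (a : ℕ) : Option ℕ :=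
  (t.values.find? fun v => v.1 == a).map fun v =>
    ((v.2.1 % (t.p : ℤ)).toNat * invModFast t.p (v.2.2 % t.p)) % t.p

/-- Sum of optional residues modulo `p` (`none` is absorbing). [folklore] -/
def addRes (x : Option ℕ) (y : Option ℕ) : Option ℕ :=
  match x, y with
  | some a, some b => some ((a + b) % t.p)
  | _, _ => none

/-- The Teichmüller-COSET SUM residue `c_s = Σ_{c=1}^{p−1} x(ω(c)·(1+p)^s mod pⁿ) mod p`
(`ω(c) = c^{p^{n−1}} mod pⁿ`). [cite: MazurTateTeitelbaum1986Invent, §I.10 (μ_E(a + pⁿℤ_p) = a_p⁻ⁿ x(a/pⁿ))] -/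
def cosetRes (s : ℕ) : Option ℕ :=
  let u := powModFast (1 + t.p) s t.q
  (List.range (t.p - 1)).foldl
    (fun acc c => t.addRes acc (t.resAt (u * powModFast (c + 1) (t.p ^ (t.n - 1)) t.q % t.q))) (some 0)

/-- The RIEMANN SUM residue `RS_k = Σ_{s < p^{n−1}} C(s, k)·c_s mod p`. [cite: SteinWuthrich2013, §3 (3.3)–(3.5)] -/
def rsRes (k : ℕ) : Option ℕ :=
  (List.range (t.p ^ (t.n - 1))).foldl
    (fun acc s => t.addRes acc ((t.cosetRes s).map fun y => (s.choose k % t.p) * y % t.p)) (some 0)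

/-- Shape of the table: `p` an odd prime, `n ≥ 1`, five a-invariants, exactly `φ(pⁿ)` entries with
`a < pⁿ`, `p ∤ a`, increasing, denominators prime to `p`, and evenness `x(pⁿ − a) ≡ x(a)`.
[cite: MazurTateTeitelbaum1986Invent, §I.10] -/
def checkShape : Bool :=
  decide (3 ≤ t.p) && isPrimeBelow504100 t.p && decide (1 ≤ t.n) && (t.ainvs.length == 5) &&
  (t.values.length == t.p ^ (t.n - 1) * (t.p - 1)) &&
  t.values.all (fun v => decide (v.1 < t.q) && decide (v.1 % t.p ≠ 0) && decide (v.2.2 % t.p ≠ 0) &&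
    ((t.values.find? fun w => w.1 == t.q - v.1).map (fun w => w.2) == some v.2)) &&
  strictlyIncreasing (t.values.map (·.1))

/-- The unit Riemann sum at the displayed index, minimal: `lam < p^{n−1}`, `RS_lam ≢ 0`,
`RS_k ≡ 0 (mod p)` for `k < lam`. [cite: SteinWuthrich2013, §3 (3.5) and §4.2] -/
def checkUnit : Bool :=
  decide (t.lam < t.p ^ (t.n - 1)) &&
  (match t.rsRes t.lam with | some r => decide (r ≠ 0) | none => false) &&
  (List.range t.lam).all (fun k => t.rsRes k == some 0)

/-- The full recheck of a μ symbol table. [cite: SteinWuthrich2013, §3] -/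
def check : Bool := t.checkShape && t.checkUnit

/-- The table is keyed to the record `r` (same label, prime, a-invariants, conductor, split bit, `x(0)`).
[folklore] -/
def keyOf (r : Record) : Bool :=
  (t.label == r.label) && (t.p == r.p) && (t.ainvs == r.ainvs) && (t.conductor == r.conductor) &&
  (t.split == r.split) && (t.x0 == r.lRatio)

end MuTable

/-- A list of μ symbol tables all pass the recheck. [cite: SteinWuthrich2013, §3] -/
def MuTableCertified (ts : List MuTable) : Prop := ts.all MuTable.check = true

/-- `MuTableCertified` is decidable (a `Bool` test). [folklore] -/
instance MuTableCertified.instDecidable (ts : List MuTable) : Decidable (MuTableCertified ts) :=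
  inferInstanceAs (Decidable (ts.all MuTable.check = true))

/-- Unpacking `MuTableCertified`. [cite: SteinWuthrich2013, §3] -/
theorem MuTableCertified.check_of_mem {ts : List MuTable} (h : MuTableCertified ts) {t : MuTable}
    (ht : t ∈ ts) : t.check = true := by
  unfold MuTableCertified at h
  exact List.all_eq_true.mp h t ht

namespace MuTable

/-- **What a μ symbol table CLAIMS about `W`** (the engines' statement proper, D-0014 claim level; the
`hx`-shape of `X11b.muAnZeroAt_of_symbolTable_modP`): a newform `f₀` of `W`, its period ratio `ϖ₀`
(`ϖ₀·Ω_E = Ω⁺_{f₀}`) and a `p`-adic unit `u ∈ ℚ` with `u·ϖ₀·[a/pⁿ]⁺_{f₀} = num/den` for every displayed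
entry `(a, num, den)`. (With the engines' normalisation `x(0) = L(E,1)/Ω_E` one expects `u = ±1`.)
A `Prop` to be ASSUMED; nothing in the tree proves it. [cite: MazurTateTeitelbaum1986Invent, §I.10 and §I.13]
[cite: SteinWuthrich2013, §3 (3.2)] -/
def ClaimFor (t : MuTable) (W : WeierstrassCurve ℚ) : Prop :=
  ∀ [Fact t.p.Prime] [W.IsElliptic],
    ∃ (N₀ : ℕ) (_ : NeZero N₀) (f₀ : CuspForm (Gamma0 N₀) 2) (ϖ₀ u : ℚ),
      IsNewformOf W f₀ ∧ (ϖ₀ : ℝ) * W.realPeriodRat = plusPeriod f₀ ∧ ‖((u : ℚ) : ℚ_[t.p])‖ = 1 ∧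
      ∀ v ∈ t.values,
        u * ϖ₀ * ratPlusSymbol f₀ ((v.1 : ℚ) / (t.p : ℚ) ^ t.n) = (v.2.1 : ℚ) / (v.2.2 : ℚ)

end MuTable

/-! ### Sanity checks -/

-- `decide`/`decide +kernel` on tables: trial division for `p`, ~p^{n−1}·(p−1) lookups per Riemann sum.
set_option maxRecDepth 100000


/-- The level-2 table of `6480d1 @ 5` (display file `RecordsLeafNonSurjMuPart1`: witness coset `{1,7,18,24}`,
sum `7`): the recheck passes with `lam = 3` (= PARI `ellpadiclambdamu` λ = 3, cell referee kit j284417), and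
a copy with a corrupted entry is rejected. [cite: SteinWuthrich2013, §3] -/
example :
    ({ label := "6480d1", ainvs := [0, 0, 0, -8532, -303156], conductor := 6480, p := 5, split := true, n := 2,
       lam := 3, x0 := (5, 1),
       values := [(1, 7, 2), (2, 1, 2), (3, -1, 2), (4, 7, 2), (6, -7, 2), (7, 0, 1), (8, 0, 1), (9, 0, 1),
                  (11, -7, 2), (12, 0, 1), (13, 0, 1), (14, -7, 2), (16, 0, 1), (17, 0, 1), (18, 0, 1),
                  (19, -7, 2), (21, 7, 2), (22, -1, 2), (23, 1, 2), (24, 7, 2)],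
       engines := [] } : MuTable).check = true := by
  decide +kernel

end Literature.NumberTheory.EllipticCurves.Rank1Residual.X11aPrintCertificates

end
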